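import Summits.ABC.ABC.Theorems.TamagawaTwistDictionaryTamagawaTwistPayoffSplitModel
import Summits.ABC.ABC.Theorems.PlacewiseSzpiroSingleTowerSzpiroStubTwistTransferOdd
import Summits.ABC.ABC.Theorems.PlacewiseSzpiroSingleTowerSzpiroStubTwistTransferTwo
import Literature.NumberTheory.DiophantineGeometry.ConductorExponentLeEightProofs
import Literature.NumberTheory.EllipticCurves.LocalEulerFactorModel
import Mathlib.NumberTheory.Padics.HeightOneSpectrum
import HarnessLib

/-!
# Route `TamagawaTwistDictionary`, crux `TamagawaTwistPayoff` (stmt-ABC-24114) — helper: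
# a SMALL quadratic twist that is split multiplicative at a given `j`-pole place

TWIST SUPPLY + TWIST LOCAL, place by place (no CRT). For an elliptic `E/ℚ` and a finite place
`v` (of `𝓞 ℚ`, prime `p`) with `ord_v(j_E) < 0` there is an elliptic `E'/ℚ` with

* `j(E') = j(E)` and SPLIT multiplicative reduction at `v`;
* `N_{E'} ∣ N_E · (2d)^8` for a natural number `0 < d < 4p²`

(`exists_split_partner`). Construction: `E ≅ T^{(d₀)}`, `T = tateFormOfJ j_E`, `d₀ ∈ ℤ`
(`WeierstrassCurve.exists_int_variableChange_eq_quadraticTwist_tateFormOfJ`); write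
`d₀ = p^e w` with `p ∤ w`, let `m ≡ w (mod 4p)`, `0 < m < 4p`, `u = m/w` (a `v`-unit,
`≡ 1 (mod 4p)` in `ℤ_(p)`), `k = (u−1)/4 ∈ 𝔪_v`, and `E' := T.twistModel k` (a model of
`T^{(u)}`): it is split multiplicative at `v` (sibling file `…SplitModel`, node polynomial
`T(T+1)`), and with `d = p^{e mod 2} m` one has `d₀d = u·(wp^c)²`, so `E.twistModel((d−1)/4)`
(a model of `E^{(d)}`) is `ℚ`-isomorphic to `E'` (`twistModel_smul`,
`exists_variableChange_twistModel_eq_quadraticTwist`, `quadraticTwist_quadraticTwist`,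
`exists_variableChange_quadraticTwist_mul_sq`). Hence `f_q(E') = f_q(E)` at every prime
`q ∤ 2d` (unramified integral twist, `conductorExponent_twistModel`; Comalada 1994) and
`f_q(E') ≤ 8` everywhere (Brumer–Kramer / Lockhart–Rosen–Silverman,
`conductorExponent_le_eight_holds`), i.e. `N_{E'} ∣ N_E · (2d)^8`.

HONESTY: bookkeeping for the line «Conj 1.14 ⟹ A1′» (Pasten's unproved remark, JNT 254 (2024)
after Thm 1.15); NOT abc, NOT A-PS. No `sorry`, no new axiom, no `def`.

References: J. H. Silverman, *AEC* (2009) X.5 Cor. 5.4.1, VII.1; *ATAEC* (1994) IV.10;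
S. Comalada, J. Number Theory 49 (1994); A. Brumer, K. Kramer, Compositio Math. 92 (1994) Thm 6.2.
-/

noncomputable section

-- `Summit.<Summit>.<Problem>` is the mandated summit-side namespace (CONVENTIONS §2); for the
-- single-conjunct summit `ABC` the two coincide, so the duplicate `ABC.ABC` is deliberate.
set_option linter.dupNamespace false

namespace Summit.ABC.ABC.Theorems.TamagawaTwistPayoffLine

open scoped NumberField
open IsDedekindDomain WeierstrassCurve Rat.HeightOneSpectrum Literature.NumberTheory.EllipticCurves

/-! ### Valuations of integers at a finite place of `ℚ` (any integer ring `R` of `ℚ`) -/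

section RatVal

variable {R : Type*} [CommRing R] [IsDedekindDomain R] [Algebra R ℚ] [IsFractionRing R ℚ]
  [IsIntegralClosure R ℤ ℚ] (v : HeightOneSpectrum R)

/-- An integer is a `v`-unit iff the prime `p_v` does not divide it. [folklore] -/
theorem rat_valuation_intCast_eq_one_iff (n : ℤ) :
    v.valuation ℚ (n : ℚ) = 1 ↔ ¬ ((natGenerator v : ℕ) : ℤ) ∣ n := by
  haveI := Fact.mk (primesEquiv v).2
  rw [(valuation_equiv_padicValuation v).eq_one_iff_eq_one, Rat.padicValuation_cast,
    Int.padicValuation_eq_one_iff]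
  exact Iff.rfl

/-- An integer lies in `𝔪_v` iff the prime `p_v` divides it. [folklore] -/
theorem rat_valuation_intCast_lt_one_iff (n : ℤ) :
    v.valuation ℚ (n : ℚ) < 1 ↔ ((natGenerator v : ℕ) : ℤ) ∣ n := by
  haveI := Fact.mk (primesEquiv v).2
  rw [(valuation_equiv_padicValuation v).lt_one_iff_lt_one, Rat.padicValuation_cast,
    Int.padicValuation_lt_one_iff]
  exact Iff.rfl

end RatVal

/-! ### The partner -/

/-- **A small twist which is split multiplicative at a `j`-pole place.** For `E/ℚ` elliptic and a
finite place `v` of `𝓞 ℚ` (prime `p`) with `ord_v(j_E) < 0` there are an elliptic `E'/ℚ` and a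
natural number `0 < d < 4p²` with `j(E') = j(E)`, `E'` SPLIT multiplicative at `v`, and
`N_{E'} ∣ N_E · (2d)^8` (`E'` is a `ℚ`-model of the quadratic twist `E^{(d)}`; see the module
docstring for the construction via the Tate form). [cite: SilvermanATAEC1994, V.5 Thm. 5.3 and IV.10]
[cite: BrumerKramer1994, Thm 6.2] -/
theorem exists_split_partner (E : WeierstrassCurve ℚ) [E.IsElliptic] (v : HeightOneSpectrum (𝓞 ℚ))
    (hj : 1 < v.valuation ℚ E.j) :
    ∃ (E' : WeierstrassCurve ℚ) (_ : E'.IsElliptic) (d : ℕ), 0 < d ∧ d < 4 * natGenerator v ^ 2 ∧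
      E'.j = E.j ∧ E'.HasSplitMultiplicativeReductionAt v ∧
      E'.conductorNorm ℤ ∣ E.conductorNorm ℤ * (2 * d) ^ 8 := by
  set p : ℕ := natGenerator v with hpdef
  have hpp : p.Prime := prime_natGenerator v
  have hp0 : (p : ℚ) ≠ 0 := by exact_mod_cast hpp.ne_zero
  obtain ⟨hj0, hj1728, -⟩ := E.j_ne_and_valuation_j_sub_eq_of_one_lt_valuation_j v hj
  haveI hTell : (tateFormOfJ E.j).IsElliptic := isElliptic_tateFormOfJ hj0 hj1728
  -- `E ≅ T^{(d₀)}`, `d₀ ∈ ℤ ∖ 0`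
  obtain ⟨d₀, hd₀0, -, C, hC⟩ := E.exists_int_variableChange_eq_quadraticTwist_tateFormOfJ hj0 hj1728
  -- `d₀ = p^e · w`, `p ∤ w`
  obtain ⟨e, n', hn', hfac⟩ :=
    Nat.exists_eq_pow_mul_and_not_dvd (Int.natAbs_ne_zero.mpr hd₀0) p hpp.ne_one
  set w : ℤ := d₀.sign * n' with hw
  have hd₀w : d₀ = (p : ℤ) ^ e * w := by
    rw [hw]
    conv_lhs => rw [← Int.sign_mul_natAbs d₀, hfac]
    push_cast; ring
  have hwabs : w.natAbs = n' := by
    rw [hw, Int.natAbs_mul, Int.natAbs_sign_of_ne_zero hd₀0, one_mul, Int.natAbs_natCast]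
  have hpw : ¬ (p : ℤ) ∣ w := fun h => hn' (by rwa [Int.natCast_dvd, hwabs] at h)
  have hw0 : w ≠ 0 := fun h => hpw (by rw [h]; exact dvd_zero _)
  have hw0q : (w : ℚ) ≠ 0 := by exact_mod_cast hw0
  -- `mz ≡ w (mod 4p)`, `0 < mz < 4p`, `mz - w = 4p · t`
  set M : ℤ := 4 * p with hM
  have hM0 : 0 < M := by
    have : (0 : ℤ) < p := by exact_mod_cast hpp.pos
    rw [hM]; linarith
  set mz : ℤ := w % M with hmz
  have hmz0 : 0 ≤ mz := Int.emod_nonneg _ hM0.ne'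
  have hmzM : mz < M := Int.emod_lt_of_pos _ hM0
  have hmzw : M ∣ mz - w := ⟨-(w / M), by rw [hmz, Int.emod_def]; ring⟩
  have hpmz : ¬ (p : ℤ) ∣ mz := by
    intro h
    apply hpw
    have h4p : (p : ℤ) ∣ M := by rw [hM]; exact Dvd.intro_left _ rfl
    have h' : (p : ℤ) ∣ mz - (mz - w) := Int.dvd_sub h (dvd_trans h4p hmzw)
    rwa [sub_sub_cancel] at h'
  have hmzpos : 0 < mz := by
    rcases hmz0.eq_or_lt with h | h
    · exact absurd (by rw [← h]; exact dvd_zero _) hpmz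
    · exact h
  obtain ⟨t, ht⟩ := hmzw
  -- the natural number `m = mz` and `d = p^{e mod 2} m`
  set m : ℕ := mz.toNat with hm
  have hmmz : (m : ℤ) = mz := Int.toNat_of_nonneg hmz0
  have hm0 : 0 < m := by omega
  have hm4p : m < 4 * p := by
    have : (m : ℤ) < 4 * p := by rw [hmmz, ← hM]; exact hmzM
    exact_mod_cast this
  set d : ℕ := p ^ (e % 2) * m with hd
  have hd0 : 0 < d := by rw [hd]; exact Nat.mul_pos (pow_pos hpp.pos _) hm0
  have hdlt : d < 4 * p ^ 2 := by
    have hpe : p ^ (e % 2) ≤ p := by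
      rcases Nat.mod_two_eq_zero_or_one e with h | h
      · rw [h, pow_zero]; exact hpp.one_lt.le
      · rw [h, pow_one]
    have h1 : d < p ^ (e % 2) * (4 * p) := by
      rw [hd]; exact mul_lt_mul_of_pos_left hm4p (pow_pos hpp.pos _)
    have h2 : p ^ (e % 2) * (4 * p) ≤ p * (4 * p) := Nat.mul_le_mul_right _ hpe
    calc d < p ^ (e % 2) * (4 * p) := h1
      _ ≤ p * (4 * p) := h2
      _ = 4 * p ^ 2 := by ring
  -- `u = m / w`, `k = (u - 1)/4 = p t / w`
  set u : ℚ := (m : ℚ) / w with hu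
  set k : ℚ := ((p : ℚ) * t) / w with hk
  have hmq : (m : ℚ) = (w : ℚ) + 4 * (p : ℚ) * t := by
    have h1 : mz = w + M * t := by linarith
    have h2 : (m : ℤ) = w + 4 * p * t := by rw [hmmz, h1, hM]
    exact_mod_cast h2
  have h4k : 4 * k + 1 = u := by
    rw [hk, hu, hmq]; field_simp; ring
  -- valuations at `v`: `k ∈ 𝔪_v`
  have hvp : v.valuation ℚ (p : ℚ) < 1 := by
    have h := (rat_valuation_intCast_lt_one_iff v (natGenerator v : ℤ)).mpr dvd_rfl
    exact_mod_cast h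
  have hvw : v.valuation ℚ (w : ℚ) = 1 := (rat_valuation_intCast_eq_one_iff v w).mpr hpw
  have hvt : v.valuation ℚ (t : ℚ) ≤ 1 := WeierstrassCurve.Rat.valuation_intCast_le_one v t
  have hvk : v.valuation ℚ k < 1 := by
    rw [hk, map_div₀, map_mul, hvw, div_one]
    calc v.valuation ℚ (p : ℚ) * v.valuation ℚ (t : ℚ) ≤ v.valuation ℚ (p : ℚ) * 1 := by gcongr
      _ = v.valuation ℚ (p : ℚ) := mul_one _
      _ < 1 := hvp
  -- the partner `E' = T.twistModel k`
  haveI hE'ell : ((tateFormOfJ E.j).twistModel k).IsElliptic :=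
    isElliptic_twistModel_tateFormOfJ v E hj hvk
  have hsplit : ((tateFormOfJ E.j).twistModel k).HasSplitMultiplicativeReductionAt v :=
    hasSplitMultiplicativeReductionAt_twistModel_tateFormOfJ v E hj hvk
  have hjE' : ((tateFormOfJ E.j).twistModel k).j = E.j := j_twistModel_tateFormOfJ v E hj k
  -- `d₀ · d = u · (w p^c)²`
  set c : ℕ := (e + e % 2) / 2 with hc
  have h2c : 2 * c = e + e % 2 := by rw [hc]; omega
  have hpow : (p : ℚ) ^ e * (p : ℚ) ^ (e % 2) = ((p : ℚ) ^ c) ^ 2 := by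
    rw [← pow_add, ← h2c, pow_mul']
  have hprod : (d₀ : ℚ) * (d : ℚ) = u * ((w : ℚ) * (p : ℚ) ^ c) ^ 2 := by
    have hdq : (d : ℚ) = (p : ℚ) ^ (e % 2) * (m : ℚ) := by rw [hd]; push_cast; ring
    have hd₀q : (d₀ : ℚ) = (p : ℚ) ^ e * (w : ℚ) := by rw [hd₀w]; push_cast; ring
    rw [hdq, hd₀q, hu]
    calc (p : ℚ) ^ e * (w : ℚ) * ((p : ℚ) ^ (e % 2) * (m : ℚ))
        = ((p : ℚ) ^ e * (p : ℚ) ^ (e % 2)) * w * m := by ring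
      _ = ((p : ℚ) ^ c) ^ 2 * w * m := by rw [hpow]
      _ = (m : ℚ) / w * ((w : ℚ) * (p : ℚ) ^ c) ^ 2 := by field_simp
  -- `E.twistModel k_d ≅ E'` over `ℚ`, `k_d = (d - 1)/4`
  set kd : ℚ := ((d : ℚ) - 1) / 4 with hkd
  have h4kd : 4 * kd + 1 = d := by rw [hkd]; field_simp; ring
  obtain ⟨D, hD⟩ : ∃ D : VariableChange ℚ,
      E.twistModel kd = D • (tateFormOfJ E.j).twistModel k := by
    -- `C₂ • twistMap kd C • E.twistModel kd = (C • E)^{(d)} = T^{(d₀ d)}`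
    obtain ⟨C₂, -, hC₂⟩ := (C • E).exists_variableChange_twistModel_eq_quadraticTwist kd
    rw [h4kd, twistModel_smul, hC, quadraticTwist_quadraticTwist] at hC₂
    -- `C₃ • T^{(u)} = T^{(u (w p^c)²)} = T^{(d₀ d)}`
    obtain ⟨C₃, hC₃⟩ := (tateFormOfJ E.j).exists_variableChange_quadraticTwist_mul_sq u
      ((w : ℚ) * (p : ℚ) ^ c) (mul_ne_zero hw0q (pow_ne_zero _ hp0))
    rw [← hprod] at hC₃
    -- `C₄ • E' = T^{(u)}`
    obtain ⟨C₄, -, hC₄⟩ := (tateFormOfJ E.j).exists_variableChange_twistModel_eq_quadraticTwist k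
    rw [h4k] at hC₄
    refine ⟨(C₂ * VariableChange.twistMap kd C)⁻¹ * (C₃ * C₄), ?_⟩
    rw [mul_smul, mul_smul, hC₄, hC₃, ← hC₂, eq_inv_smul_iff, mul_smul]
  -- conductor exponents at the places of `ℤ` away from `2d`
  have hexp : ∀ wq : HeightOneSpectrum ℤ, natGenerator wq ≠ 2 → ¬ (natGenerator wq ∣ d) →
      ((tateFormOfJ E.j).twistModel k).conductorExponent wq = E.conductorExponent wq := by
    intro wq hq2 hqd
    have hqq : (natGenerator wq).Prime := prime_natGenerator wq
    have hvd : wq.valuation ℚ (d : ℚ) = 1 := by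
      have h := (rat_valuation_intCast_eq_one_iff wq (d : ℤ)).mpr (by exact_mod_cast hqd)
      exact_mod_cast h
    have hv4 : wq.valuation ℚ (4 : ℚ) = 1 := by
      have h := (rat_valuation_intCast_eq_one_iff wq (4 : ℤ)).mpr (by
        intro h
        have h2 : natGenerator wq ∣ 2 ^ 2 := by exact_mod_cast h
        exact hq2 ((Nat.prime_dvd_prime_iff_eq hqq Nat.prime_two).mp (hqq.dvd_of_dvd_pow h2)))
      exact_mod_cast h
    have hvkd : wq.valuation ℚ kd ≤ 1 := by
      rw [hkd, map_div₀, hv4, div_one]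
      have h : wq.valuation ℚ ((((d : ℤ) - 1 : ℤ)) : ℚ) ≤ 1 := by
        rw [show ((((d : ℤ) - 1 : ℤ)) : ℚ) = algebraMap ℤ ℚ ((d : ℤ) - 1) from (eq_intCast _ _).symm]
        exact HeightOneSpectrum.valuation_le_one wq _
      push_cast at h
      exact h
    have hvkd' : wq.valuation ℚ (4 * kd + 1) = 1 := by rw [h4kd]; exact hvd
    calc ((tateFormOfJ E.j).twistModel k).conductorExponent wq
        = (D • (tateFormOfJ E.j).twistModel k).conductorExponent wq :=
          (WeierstrassCurve.conductorExponent_smul' wq _ D).symm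
      _ = (E.twistModel kd).conductorExponent wq := by rw [hD]
      _ = E.conductorExponent wq := conductorExponent_twistModel wq E hvkd hvkd'
  -- `N_{E'} ∣ N_E · (2d)^8`
  have hdvd : ((tateFormOfJ E.j).twistModel k).conductorNorm ℤ ∣ E.conductorNorm ℤ * (2 * d) ^ 8 := by
    have hN' : ((tateFormOfJ E.j).twistModel k).conductorNorm ℤ ≠ 0 := (conductorNorm_pos_holds _).ne'
    have hN : E.conductorNorm ℤ ≠ 0 := (conductorNorm_pos_holds E).ne'
    have h2d0 : 2 * d ≠ 0 := by omega
    have h2d : (2 * d) ^ 8 ≠ 0 := pow_ne_zero _ h2d0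
    rw [← Nat.factorization_le_iff_dvd hN' (mul_ne_zero hN h2d), Nat.factorization_mul hN h2d,
      Nat.factorization_pow, Finsupp.le_def]
    intro q
    rw [Finsupp.add_apply, Finsupp.smul_apply, smul_eq_mul]
    by_cases hq : q.Prime
    · set wq : HeightOneSpectrum ℤ := (primesEquiv (R := ℤ)).symm ⟨q, hq⟩ with hwq
      have hwqq : natGenerator wq = q :=
        Literature.NumberTheory.EllipticCurves.Rat.natGenerator_primesEquiv_symm ⟨q, hq⟩
      rw [factorization_conductorNorm_primesEquiv_symm _ ⟨q, hq⟩,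
        factorization_conductorNorm_primesEquiv_symm E ⟨q, hq⟩, ← hwq]
      by_cases hq2d : q ∣ 2 * d
      · have h8 : ((tateFormOfJ E.j).twistModel k).conductorExponent wq ≤ 8 :=
          conductorExponent_le_eight_holds _ wq
        have h1 : 0 < (2 * d).factorization q := Nat.Prime.factorization_pos_of_dvd hq h2d0 hq2d
        omega
      · have hq2 : q ≠ 2 := fun h => hq2d (h ▸ dvd_mul_right 2 d)
        have hqd : ¬ q ∣ d := fun h => hq2d (dvd_mul_of_dvd_right h 2)
        rw [hexp wq (by rw [hwqq]; exact hq2) (by rw [hwqq]; exact hqd)]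
        exact Nat.le_add_right _ _
    · rw [Nat.factorization_eq_zero_of_not_prime _ hq]; exact Nat.zero_le _
  exact ⟨(tateFormOfJ E.j).twistModel k, hE'ell, d, hd0, hdlt, hjE', hsplit, hdvd⟩

end Summit.ABC.ABC.Theorems.TamagawaTwistPayoffLine

end
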